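import Literature.Topology.FourManifolds.HCobordismPartialProduct
import Literature.Topology.FourManifolds.SPC4Wave0
import Literature.Barriers.SmoothPoincare4.ExoticOpenFourSpaceTransport
import HarnessLib

/-!
# The small exotic `ℝ⁴`: the three printed phrasings are equivalent (proofs only)

Proof file (theorems only, no named fact) next to `SmallExoticRFour.lean` (the PROVED bridge
"Casson–Freedman ∧ Donaldson ⟹ spc4.S11") for the tree's named fact
`Literature.Topology.FourManifolds.exists_opens_nonempty_homeomorph_isEmpty_diffeomorph_euclideanSpace_four`
(**spc4.S11**, `SPC4Wave0.lean`; Mathlib's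
`proof_wanted exists_open_nonempty_homeomorph_isEmpty_diffeomorph_euclideanSpace_four`): *some
open subset of `ℝ⁴`, with the smooth structure induced from `ℝ⁴`, is homeomorphic but not
diffeomorphic to `ℝ⁴`*. The sources print this existence statement in three shapes:

* (open subset of `ℝ⁴`) S. DeMichelis, M. H. Freedman, *Uncountably many exotic `R⁴`'s in
  standard 4-space*, J. Differential Geom. 35 (1992), Thm. 4.1, first sentence (p. 246): "There
  is a subset `R⁴₁` of Euclidean 4-space `R⁴_std` which is homeomorphic but not diffeomorphic to
  `R⁴_std`" (§4, p. 246: "Any open subset of a Euclidean space acquires a natural smooth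
  structure by restriction") — the tree's form;
* (inside `S⁴`) R. C. Kirby, *The Topology of 4-Manifolds*, LNM 1374 (1989), Ch. XIV, Thm. 3
  (p. 98): "There exists an exotic `R⁴_Θ` which imbeds smoothly in `S⁴`";
* (abstract manifold) DeMichelis–Freedman, Thm. 3.1 (3), (6) (p. 234): `V₀` is "homeomorphic but
  not diffeomorphic to `R⁴`" and "inherit[s its] smooth structure as [an] open subset of `R⁴_std`"
  — a smooth 4-manifold homeomorphic to `ℝ⁴`, not diffeomorphic to `ℝ⁴`, diffeomorphic to an open
  subset of standard `ℝ⁴`.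

PROVED here: the three shapes are equivalent
(`exists_opens_sphere_four_iff_exists_opens_euclidean`,
`exists_manifold_four_iff_exists_opens_euclidean`), through the elementary facts that an open
subset of Mathlib's `S⁴` missing a point is diffeomorphic to an open subset of `ℝ⁴` (a
stereographic chart, `exists_opens_euclidean_diffeomorph_of_not_mem`), that an `ℝ⁴`-homeomorph in
`S⁴` misses a point (`exists_not_mem_of_homeomorph_euclidean`, compactness), and that every open
subset of `ℝ⁴` is diffeomorphic to one of `S⁴` (`exists_opens_sphere_diffeomorph`, the barrier
file's stereographic pull-back); and, for the end data
`Literature.Topology.FourManifolds.PartialProductEnds` of `HCobordismPartialProduct.lean`,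
DeMichelis–Freedman's clause (6) for the end `Z₀`: it is diffeomorphic to an open subset of `S⁴`
(the datum `j₀`) and hence of `ℝ⁴` (`PartialProductEnds.exists_opens_euclidean_diffeomorph_Z₀`).
Nothing here is a named fact; the smooth plumbing is
`Literature.Barriers.SmoothPoincare4.opensDiffeomorphOfSubsetTarget` /
`spherePullbackDiffeomorph` (`Barriers/SmoothPoincare4/ExoticOpenFourSpace{,Transport}.lean`).

Provefact triage of spc4.S11 (this seat): `SIZE: XL`. With `SmallExoticRFour.lean` the fact is
proved relative to exactly `Literature.Topology.FourManifolds.cassonFreedman_partialProductEnds` (Casson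
handles, Freedman 1982 Thm. 1.1) and `Literature.Topology.FourManifolds.exists_isHCobordant_isEmpty_diffeomorph_four`
(Donaldson 1987); an unconditional `…_holds` needs those two discharged.

## References

[Kirby1989] [DeMichelisFreedman1992]
-/

open scoped Manifold ContDiff
open TopologicalSpace Set

noncomputable section

namespace Literature.Topology.FourManifolds

/-! ### Open subsets of `S⁴` versus open subsets of `ℝ⁴` -/

/-- **An open subset of `S⁴` missing a point is diffeomorphic to an open subset of `ℝ⁴`**: if
`q ∉ U` then the stereographic chart `χ₋q` of Mathlib's `S⁴` (source `{q}ᶜ`, target all of `ℝ⁴`)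
restricts to a diffeomorphism of `U` onto the open set `χ₋q(U) ⊆ ℝ⁴`, both sides with their
open-submanifold structures (`Literature.Barriers.SmoothPoincare4.opensDiffeomorphOfSubsetTarget`
applied to `χ₋q.symm`, smooth by `contMDiffOn_chart_symm`/`contMDiffOn_chart`). This is the step
"imbeds smoothly in `S⁴`" ⇒ "open subset of `R⁴_std`" between Kirby's and DeMichelis–Freedman's
phrasings ("an exotic `ℝ⁴` smoothly inside `S⁴` misses a point, so it is an open subset of
`S⁴ ∖ pt ≅ ℝ⁴`"). [folklore] -/
theorem exists_opens_euclidean_diffeomorph_of_not_mem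
    (U : Opens (Metric.sphere (0 : EuclideanSpace ℝ (Fin (4 + 1))) 1))
    {q : Metric.sphere (0 : EuclideanSpace ℝ (Fin (4 + 1))) 1} (hq : q ∉ U) :
    ∃ U' : Opens (EuclideanSpace ℝ (Fin 4)), Nonempty (U ≃ₘ⟮𝓡 4, 𝓡 4⟯ U') := by
  set c := chartAt (EuclideanSpace ℝ (Fin 4)) (-q) with hc
  have hsrc : c.source = {q}ᶜ := by
    simp [hc, chartAt, ChartedSpace.chartAt, stereographic'_source]
  have hU : (U : Set (Metric.sphere (0 : EuclideanSpace ℝ (Fin (4 + 1))) 1)) ⊆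
      c.symm.target := by
    rw [OpenPartialHomeomorph.symm_target, hsrc]
    intro x hx hxq
    exact hq (hxq ▸ hx)
  refine ⟨Literature.Barriers.SmoothPoincare4.pullbackOpens c.symm U, ⟨?_⟩⟩
  refine (Literature.Barriers.SmoothPoincare4.opensDiffeomorphOfSubsetTarget (𝓡 4) (𝓡 4) c.symm
    ?_ ?_ U hU).symm
  · rw [OpenPartialHomeomorph.symm_source]
    exact contMDiffOn_chart_symm
  · rw [OpenPartialHomeomorph.symm_symm, OpenPartialHomeomorph.symm_target]
    exact contMDiffOn_chart

/-- **An open subset of `S⁴` homeomorphic to `ℝ⁴` misses a point**: otherwise it would be all of the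
compact `S⁴`, while `ℝ⁴` is not compact. [folklore] -/
theorem exists_not_mem_of_homeomorph_euclidean
    (U : Opens (Metric.sphere (0 : EuclideanSpace ℝ (Fin (4 + 1))) 1))
    (e : U ≃ₜ EuclideanSpace ℝ (Fin 4)) :
    ∃ q : Metric.sphere (0 : EuclideanSpace ℝ (Fin (4 + 1))) 1, q ∉ U := by
  by_contra h
  push Not at h
  have hc : IsCompact (U : Set (Metric.sphere (0 : EuclideanSpace ℝ (Fin (4 + 1))) 1)) := by
    rw [eq_univ_of_forall h]
    exact isCompact_univ
  haveI : CompactSpace U := isCompact_iff_compactSpace.mp hc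
  exact not_compactSpace_iff.mpr (inferInstance : NoncompactSpace (EuclideanSpace ℝ (Fin 4)))
    e.compactSpace

/-- **Every open subset of `ℝ⁴` is diffeomorphic to an open subset of `S⁴`**: pull it back along a
stereographic chart (the barrier file's
`Literature.Barriers.SmoothPoincare4.spherePullbackDiffeomorph`). [folklore] -/
theorem exists_opens_sphere_diffeomorph (U' : Opens (EuclideanSpace ℝ (Fin 4))) :
    ∃ U : Opens (Metric.sphere (0 : EuclideanSpace ℝ (Fin (4 + 1))) 1),
      Nonempty (U ≃ₘ⟮𝓡 4, 𝓡 4⟯ U') :=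
  let v : Metric.sphere (0 : EuclideanSpace ℝ (Fin (4 + 1))) 1 :=
    ⟨EuclideanSpace.single 0 1, by simp⟩
  ⟨_, ⟨Literature.Barriers.SmoothPoincare4.spherePullbackDiffeomorph v U'⟩⟩

/-- **"Imbeds smoothly in `S⁴`" ⇔ "imbeds smoothly in `ℝ⁴`" for an `ℝ⁴`-homeomorph**: a charted
space `V` homeomorphic to `ℝ⁴` is diffeomorphic to an open subset of `S⁴` iff it is diffeomorphic
to an open subset of `ℝ⁴` (`→`: the open subset of `S⁴` is an `ℝ⁴`-homeomorph, so misses a point;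
`←`: stereographic pull-back). [folklore] -/
theorem exists_opens_sphere_diffeomorph_iff {V : Type*} [TopologicalSpace V]
    [ChartedSpace (EuclideanSpace ℝ (Fin 4)) V] (e : V ≃ₜ EuclideanSpace ℝ (Fin 4)) :
    (∃ U : Opens (Metric.sphere (0 : EuclideanSpace ℝ (Fin (4 + 1))) 1),
        Nonempty (V ≃ₘ⟮𝓡 4, 𝓡 4⟯ U)) ↔
      ∃ U' : Opens (EuclideanSpace ℝ (Fin 4)), Nonempty (V ≃ₘ⟮𝓡 4, 𝓡 4⟯ U') := by
  constructor
  · rintro ⟨U, ⟨d⟩⟩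
    obtain ⟨q, hq⟩ := exists_not_mem_of_homeomorph_euclidean U (d.symm.toHomeomorph.trans e)
    obtain ⟨U', ⟨d'⟩⟩ := exists_opens_euclidean_diffeomorph_of_not_mem U hq
    exact ⟨U', ⟨d.trans d'⟩⟩
  · rintro ⟨U', ⟨d'⟩⟩
    obtain ⟨U, ⟨d⟩⟩ := exists_opens_sphere_diffeomorph U'
    exact ⟨U, ⟨d'.trans d.symm⟩⟩

/-! ### The three phrasings of "a small exotic `ℝ⁴` exists" are equivalent -/

/-- **Kirby's printed form ⇔ the tree's form.** "There exists an exotic `R⁴_Θ` which imbeds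
smoothly in `S⁴`" (Kirby 1989, Thm. XIV.3), read as: some open subset of the standard smooth `S⁴`
(Mathlib's unit sphere of `ℝ⁵`, the open subset with its open-submanifold structure) is
homeomorphic but not diffeomorphic to `ℝ⁴` — holds iff spc4.S11 does (some open subset of `ℝ⁴` is
homeomorphic but not diffeomorphic to `ℝ⁴`). `→`: the exotic open `U ⊆ S⁴` misses a point and is
then diffeomorphic to an open `U' ⊆ ℝ⁴`, which inherits both properties; `←`: the barrier file's
`Literature.Barriers.SmoothPoincare4.exists_opens_sphere_homeomorph_not_diffeomorph` (stereographic
pull-back). [cite: Kirby1989, Ch. XIV Thm. 3 (p. 98)] -/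
theorem exists_opens_sphere_four_iff_exists_opens_euclidean :
    (∃ U : Opens (Metric.sphere (0 : EuclideanSpace ℝ (Fin (4 + 1))) 1),
        Nonempty (U ≃ₜ EuclideanSpace ℝ (Fin 4)) ∧
          IsEmpty (U ≃ₘ⟮𝓡 4, 𝓡 4⟯ EuclideanSpace ℝ (Fin 4))) ↔
      exists_opens_nonempty_homeomorph_isEmpty_diffeomorph_euclideanSpace_four := by
  constructor
  · rintro ⟨U, ⟨e⟩, hE⟩
    obtain ⟨q, hq⟩ := exists_not_mem_of_homeomorph_euclidean U e
    obtain ⟨U', ⟨d⟩⟩ := exists_opens_euclidean_diffeomorph_of_not_mem U hq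
    exact ⟨U', ⟨d.symm.toHomeomorph.trans e⟩, ⟨fun d' => hE.false (d.trans d')⟩⟩
  · exact Literature.Barriers.SmoothPoincare4.exists_opens_sphere_homeomorph_not_diffeomorph

/-- **The abstract form ⇔ the tree's form.** There is a smooth 4-manifold `R` (Hausdorff, second
countable, `C^∞` atlas on `ℝ⁴`, in `Type`) homeomorphic to `ℝ⁴`, not diffeomorphic to `ℝ⁴`, and
diffeomorphic to an open subset of standard `ℝ⁴` (DeMichelis–Freedman's `V₀`, Thm. 3.1 (3), (6);
Kirby's `R⁴_{Θ₀}`) iff spc4.S11 holds. `→`: transport along `R ≅ U`; `←`: an exotic open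
`U ⊆ ℝ⁴` is itself such a manifold ("any open subset of a Euclidean space acquires a natural smooth
structure by restriction", §4 p. 246), diffeomorphic to the open subset `U` by the identity.
[cite: DeMichelisFreedman1992, Thm. 3.1 (3), (6) (p. 234) and Thm. 4.1 (p. 246)] -/
theorem exists_manifold_four_iff_exists_opens_euclidean :
    (∃ (R : Type) (_ : TopologicalSpace R) (_ : T2Space R) (_ : SecondCountableTopology R)
        (_ : ChartedSpace (EuclideanSpace ℝ (Fin 4)) R) (_ : IsManifold (𝓡 4) ∞ R),
        Nonempty (R ≃ₜ EuclideanSpace ℝ (Fin 4)) ∧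
          IsEmpty (R ≃ₘ⟮𝓡 4, 𝓡 4⟯ EuclideanSpace ℝ (Fin 4)) ∧
            ∃ U : Opens (EuclideanSpace ℝ (Fin 4)), Nonempty (R ≃ₘ⟮𝓡 4, 𝓡 4⟯ U)) ↔
      exists_opens_nonempty_homeomorph_isEmpty_diffeomorph_euclideanSpace_four := by
  constructor
  · rintro ⟨R, _, _, _, _, _, ⟨e⟩, hE, U, ⟨d⟩⟩
    exact ⟨U, ⟨d.symm.toHomeomorph.trans e⟩, ⟨fun d' => hE.false (d.trans d')⟩⟩
  · rintro ⟨U, hU, hE⟩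
    exact ⟨U, inferInstance, inferInstance, inferInstance, inferInstance, inferInstance, hU, hE,
      U, ⟨Diffeomorph.refl (𝓡 4) U ∞⟩⟩

/-- **The abstract form with `S⁴` in place of `ℝ⁴` as the ambient space ⇔ the tree's form**
(Kirby's "exotic `R⁴_Θ` which imbeds smoothly in `S⁴`" read literally: an abstract smooth
`ℝ⁴`-homeomorph, not diffeomorphic to `ℝ⁴`, diffeomorphic to an open subset of `S⁴`), by
`exists_opens_sphere_diffeomorph_iff` and `exists_manifold_four_iff_exists_opens_euclidean`.
[cite: Kirby1989, Ch. XIV Thm. 3 (p. 98)] -/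
theorem exists_manifold_four_sphere_iff_exists_opens_euclidean :
    (∃ (R : Type) (_ : TopologicalSpace R) (_ : T2Space R) (_ : SecondCountableTopology R)
        (_ : ChartedSpace (EuclideanSpace ℝ (Fin 4)) R) (_ : IsManifold (𝓡 4) ∞ R),
        Nonempty (R ≃ₜ EuclideanSpace ℝ (Fin 4)) ∧
          IsEmpty (R ≃ₘ⟮𝓡 4, 𝓡 4⟯ EuclideanSpace ℝ (Fin 4)) ∧
            ∃ U : Opens (Metric.sphere (0 : EuclideanSpace ℝ (Fin (4 + 1))) 1),
              Nonempty (R ≃ₘ⟮𝓡 4, 𝓡 4⟯ U)) ↔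
      exists_opens_nonempty_homeomorph_isEmpty_diffeomorph_euclideanSpace_four := by
  rw [← exists_manifold_four_iff_exists_opens_euclidean]
  constructor
  · rintro ⟨R, _, _, _, _, _, ⟨e⟩, hE, hS⟩
    exact ⟨R, ‹_›, ‹_›, ‹_›, ‹_›, ‹_›, ⟨e⟩, hE, (exists_opens_sphere_diffeomorph_iff e).mp hS⟩
  · rintro ⟨R, _, _, _, _, _, ⟨e⟩, hE, hS⟩
    exact ⟨R, ‹_›, ‹_›, ‹_›, ‹_›, ‹_›, ⟨e⟩, hE, (exists_opens_sphere_diffeomorph_iff e).mpr hS⟩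

/-! ### DeMichelis–Freedman's clause (6) for the end `Z₀` of a partial product structure -/

namespace PartialProductEnds

universe u

variable {X₀ X₁ : Type u} [TopologicalSpace X₀] [ChartedSpace (EuclideanSpace ℝ (Fin 4)) X₀]
  [TopologicalSpace X₁] [ChartedSpace (EuclideanSpace ℝ (Fin 4)) X₁]

/-- **`Z₀` is diffeomorphic to an open subset of `S⁴`**: the smooth open embedding `j₀ : Z₀ ↪ S⁴`
of the end data ("`Z₀` lies in `S⁴ × 0`", Kirby p. 101) restricts to a diffeomorphism of the open
submanifold `Z₀ = j₀.source` (as the open subset `⟨Z₀, isOpen_Z₀⟩` of `X₀`) onto the open subset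
`j₀.target ⊆ S⁴` (`Literature.Barriers.SmoothPoincare4.opensDiffeomorphOfSubsetTarget`).
[cite: Kirby1989, Ch. XIV Thm. 3 (proof p. 101)] -/
theorem exists_opens_sphere_diffeomorph_Z₀ (D : PartialProductEnds X₀ X₁) :
    ∃ U : Opens (Metric.sphere (0 : EuclideanSpace ℝ (Fin (4 + 1))) 1),
      Nonempty ((⟨D.Z₀, D.isOpen_Z₀⟩ : Opens X₀) ≃ₘ⟮𝓡 4, 𝓡 4⟯ U) := by
  let T : Opens (Metric.sphere (0 : EuclideanSpace ℝ (Fin (4 + 1))) 1) :=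
    ⟨D.j₀.target, D.j₀.open_target⟩
  have hT : (⟨D.Z₀, D.isOpen_Z₀⟩ : Opens X₀) =
      Literature.Barriers.SmoothPoincare4.pullbackOpens D.j₀ T := by
    ext x
    change x ∈ D.Z₀ ↔ x ∈ D.j₀.source ∩ D.j₀ ⁻¹' D.j₀.target
    rw [← D.j₀_source]
    exact ⟨fun hx => ⟨hx, D.j₀.map_source hx⟩, fun hx => hx.1⟩
  exact ⟨T, ⟨(Literature.Barriers.SmoothPoincare4.diffeomorphOfEq (𝓡 4) hT).trans
    (Literature.Barriers.SmoothPoincare4.opensDiffeomorphOfSubsetTarget (𝓡 4) (𝓡 4) D.j₀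
      D.contMDiffOn_j₀ D.contMDiffOn_j₀_symm T Subset.rfl)⟩⟩

/-- **`Z₀` is diffeomorphic to an open subset of standard `ℝ⁴`** — DeMichelis–Freedman's
Thm. 3.1 (6), "`V₀` (and hence `V₁`) inherit their smooth structure as open subsets of `R⁴_std`",
for the end data: from the `S⁴` embedding and `exists_opens_sphere_diffeomorph_iff` (`Z₀ ≈ ℝ⁴`, so
its image misses a point of `S⁴`). [cite: DeMichelisFreedman1992, Thm. 3.1 (6) (p. 234)] -/
theorem exists_opens_euclidean_diffeomorph_Z₀ (D : PartialProductEnds X₀ X₁) :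
    ∃ U' : Opens (EuclideanSpace ℝ (Fin 4)),
      Nonempty ((⟨D.Z₀, D.isOpen_Z₀⟩ : Opens X₀) ≃ₘ⟮𝓡 4, 𝓡 4⟯ U') := by
  have e : (⟨D.Z₀, D.isOpen_Z₀⟩ : Opens X₀) ≃ₜ EuclideanSpace ℝ (Fin 4) :=
    D.nonempty_homeomorph_Z₀.some
  exact (exists_opens_sphere_diffeomorph_iff e).mp D.exists_opens_sphere_diffeomorph_Z₀

/-- The same for the other end `Z₁` (by the symmetry `PartialProductEnds.symm` of the end data).
[cite: DeMichelisFreedman1992, Thm. 3.1 (6) (p. 234)] -/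
theorem exists_opens_euclidean_diffeomorph_Z₁ (D : PartialProductEnds X₀ X₁) :
    ∃ U' : Opens (EuclideanSpace ℝ (Fin 4)),
      Nonempty ((⟨D.Z₁, D.isOpen_Z₁⟩ : Opens X₁) ≃ₘ⟮𝓡 4, 𝓡 4⟯ U') :=
  D.symm.exists_opens_euclidean_diffeomorph_Z₀

end PartialProductEnds

end Literature.Topology.FourManifolds

end
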